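/-
Copyright: cell pub-balaban-gaps (YM BLITZ Y1, track G1), seat g1-p2 GEN 7 (unit `pub-balaban-gaps-g1-p2`).  Row (D4) NODE O,
OBJECT level: the AVERAGING CORRECTION of (3.57)–(3.60) — `a(Lʲη)⁻²(Q′(U′)*Q′(U′) − Q′*Q′)`, the part of `V′(A)` coming from the
covariant block averages — added to the covariant shift `V_W` of `D4WalkBlockCovariantShift` as an ABSTRACT CUBE-LOCAL bounded
perturbation `V_av(u)` (entries vanish across cubes; row sums at most `α_av`; holomorphic in `u`): it fills the `α₀`-slot of
`D4WalkBlockDerivative.blockWalkExpansion_perturb_of_derivLetters` at NO cost in `η` (a cube-local left factor costs its diagonal block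
bound and no cube sum, 55's `blockNorm_localMul_le`).  END: Cor. 3.5's step for `(G′ ⊗ 1)(1 − (V_W + V_av)(G′ ⊗ 1))⁻¹`, constants uniform
in `K`, the volume and the fibre.  HONEST FRAMING: `V_av` is a hypothesis family (print's covariant averaging operators are NOT constructed
here; for them cube-locality is «Q′ averages over the L^j-blocks = the unit cubes» and `α_av = O(α₁)` by (3.37) along the block contours);
(D4) instance 0∕1; NOT BetaPertH, NOT continuum, NOT Clay.
-/
import Summits.QuantumFields.BalabanUV.Gaps.D4WalkBlockCovariantShift

/-!
# `Gaps.D4WalkBlockCovariantAveraging` — the covariant shift plus a cube-local averaging correction: Cor. 3.5's step for the full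
# first-order perturbation shape `V′(A) = V_W + V_av` of (3.60) (cell pub-balaban-gaps, seat g1-p2 gen 7)

HONEST DEPENDENCY (cell pub-balaban, verbatim): continuum YM on T⁴ ⇐ BetaPertH ∧ nine spine estimates (0/9 proved);
BetaPertH ⇐ (D1) ∧ (D4) ∧ CAP+tail.

* §1 `blockNorm_cubeLocal_le` (diagonal block bound of a cube-local matrix from its row sums), **`covShiftAv_dominated`**: the (3.61)
  letter of `V_W(u) + V_av(u)` — `‖(V_W + V_av)S‖_{Y,Y′} ≤ (α′ + α_av)‖S‖_{Y,Y′} + Σ_ι α‖D_ιS‖_{Y,Y′}`; `covShiftAv_holo`.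
* §2 **`blockWalkExpansion_covShiftAv_oneScaleTorus`** — Cor. 3.5's step on the genuine fibred flat propagator for the perturbation
  `V_W + V_av` (59b's END is the case `V_av = 0`), margin `c_μ(c_μ·1·(1·((α′ + α_av + Σ_ι α·covB δ₀ ι)C))c_μ)c_μ < 1`.
References: T. Bałaban, Comm. Math. Phys. **99** (1985) 389–434 [B9], (3.50)–(3.54) pp. 400–401, (3.57)–(3.61) pp. 401–402, Cor. 3.5 p. 407.
-/

noncomputable section

namespace Summit.QuantumFields.BalabanUV.Gaps.D4WalkBlockCovariantAveraging

open Metric Set Finset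
open scoped Matrix
open Literature.MathematicalPhysics.QuantumFieldTheory.Balaban1983to89
open Literature.MathematicalPhysics.QuantumFieldTheory.Balaban1983to89.B9SectDWalk (DomBy)
open Literature.MathematicalPhysics.QuantumFieldTheory.Balaban1983to89.B9Thm34Ext (toB6)
open Literature.MathematicalPhysics.QuantumFieldTheory.Balaban1983to89.B9Thm37GlueTorus (torusGeom tdist1)
open Literature.MathematicalPhysics.QuantumFieldTheory.Balaban1983to89.TreeLengthTorus (TPt)
open Literature.MathematicalPhysics.QuantumFieldTheory.Balaban1983to89.B5TorusCover (UT)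
open Literature.MathematicalPhysics.QuantumFieldTheory.Balaban1983to89.B11SectG (RowSum)
open Literature.MathematicalPhysics.QuantumFieldTheory.Balaban1983to89.B5Ineq137Torus (Nv)
open Literature.MathematicalPhysics.QuantumFieldTheory.Balaban1983to89.B6Prop22OneScaleTorus (Index)
open Literature.MathematicalPhysics.QuantumFieldTheory.Balaban1983to89.B1RG242Torus (tower deriv)
open Summit.QuantumFields.BalabanUV.Gaps.D4WalkBlock
  (rowMass blockNorm blockNorm_nonneg blockNorm_le_of_rowMass_le blockNorm_add_le BlockWalkExpansion)
open Summit.QuantumFields.BalabanUV.Gaps.D4WalkBlockDerivative (blockNorm_localMul_le blockWalkExpansion_perturb_of_derivLetters)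
open Summit.QuantumFields.BalabanUV.Gaps.D4WalkBlockFlatLetters (cubeOf blockWalkExpansion_const)
open Summit.QuantumFields.BalabanUV.Gaps.D4WalkBlockFlatFibre (flatLettersFibre_oneScaleTorus)
open Summit.QuantumFields.BalabanUV.Gaps.D4WalkBlockCovariantGeometry (SBf blockNorm_SBf_mul_le)
open Summit.QuantumFields.BalabanUV.Gaps.D4WalkBlockCovariantShift
  (Df covDop covB covShift covShift_dominated covShift_holo)

/-! ## §1. The (3.61) letter and holomorphy of `V_W + V_av` -/

section Letter
variable (P : Params) (F : Type) [Fintype F] [DecidableEq F]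
variable {E : Type*} [NormedAddCommGroup E] [NormedSpace ℂ E]
variable (Wp Wm : Fin P.d → E → Site P 0 → Matrix F F ℂ) (Vav : E → Matrix (Site P 0 × F) (Site P 0 × F) ℂ)

omit [DecidableEq F] in
/-- The diagonal block bound of a matrix from a uniform bound on its FULL row sums. -/
theorem blockNorm_cubeLocal_le {ν : ℕ} {Kv : Fin ν → ℕ} (cub : Site P 0 × F → UT Kv) (V : Matrix (Site P 0 × F) (Site P 0 × F) ℂ)
    {β : ℝ} (hβ : 0 ≤ β) (hrow : ∀ p, ∑ q, ‖V p q‖ ≤ β) (Y Y' : UT Kv) : blockNorm cub cub V Y Y' ≤ β := by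
  refine blockNorm_le_of_rowMass_le cub cub V Y Y' hβ fun p _ => le_trans ?_ (hrow p)
  exact Finset.sum_le_sum_of_subset_of_nonneg (Finset.filter_subset _ _) fun _ _ _ => norm_nonneg _

omit [NormedSpace ℂ E] in
/-- **THE (3.61) LETTER OF `V_W + V_av`.**  The two windows of `D4WalkBlockCovariantShift.covShift_dominated` for the defects, plus a
CUBE-LOCAL `V_av(u)` (entries vanish across cubes) with full row sums at most `α_av` on the ball ⟹
`‖(V_W(u) + V_av(u))S‖_{Y,Y′} ≤ (α′ + α_av)‖S‖_{Y,Y′} + Σ_ι α‖D_ιS‖_{Y,Y′}`.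
[cite: Balaban1985BackgroundPropagators, (3.57)–(3.61) pp.401–402, (3.37) p.396] -/
theorem covShiftAv_dominated {ν : ℕ} {Kv : Fin ν → ℕ} (cub : Site P 0 → UT Kv) {R α α' αav : ℝ} (hα : 0 ≤ α) (hα' : 0 ≤ α')
    (hαav : 0 ≤ αav)
    (hWp : ∀ μ, ∀ u ∈ ball (0 : E) R, ∀ x a, ∑ b, ‖Wp μ u x a b‖ ≤ P.eps * α)
    (hWm : ∀ μ, ∀ u ∈ ball (0 : E) R, ∀ x a, ∑ b, ‖Wm μ u x a b‖ ≤ P.eps * α)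
    (hdiv : ∀ u ∈ ball (0 : E) R, ∀ x a, ∑ b, ‖(∑ μ, (Wp μ u x + Wm μ u x)) a b‖ ≤ P.eps ^ 2 * α')
    (hloc : ∀ u p q, Vav u p q ≠ 0 → cub p.1 = cub q.1)
    (hav : ∀ u ∈ ball (0 : E) R, ∀ p, ∑ q, ‖Vav u p q‖ ≤ αav) :
    ∀ u ∈ ball (0 : E) R, ∀ (S : Matrix (Site P 0 × F) (Site P 0 × F) ℂ) (Y Y' : UT Kv),
      blockNorm (fun p : Site P 0 × F => cub p.1) (fun p : Site P 0 × F => cub p.1) ((covShift P F Wp Wm u + Vav u) * S) Y Y' ≤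
        (α' + αav) * blockNorm (fun p : Site P 0 × F => cub p.1) (fun p : Site P 0 × F => cub p.1) S Y Y' +
          ∑ ι, α * blockNorm (fun p : Site P 0 × F => cub p.1) (fun p : Site P 0 × F => cub p.1) (covDop P F ι * S) Y Y' := by
  intro u hu S Y Y'
  have h1 := covShift_dominated (Wp := Wp) (Wm := Wm) cub hα hα' hWp hWm hdiv u hu S Y Y'
  have h2 : blockNorm (fun p : Site P 0 × F => cub p.1) (fun p : Site P 0 × F => cub p.1) (Vav u * S) Y Y' ≤
      αav * blockNorm (fun p : Site P 0 × F => cub p.1) (fun p : Site P 0 × F => cub p.1) S Y Y' :=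
    blockNorm_localMul_le (fun p : Site P 0 × F => cub p.1) (fun p : Site P 0 × F => cub p.1)
      (fun p : Site P 0 × F => cub p.1) (Vav u) S (hloc u)
      (fun Y'' => blockNorm_cubeLocal_le P F (fun p : Site P 0 × F => cub p.1) (Vav u) hαav (hav u hu) Y'' Y'') Y Y'
  rw [Matrix.add_mul]
  calc _ ≤ _ := blockNorm_add_le _ _ _ _ Y Y'
    _ ≤ _ := add_le_add h1 h2
    _ = _ := by ring

/-- `V_W(u) + V_av(u)` is entrywise holomorphic when the defects and `V_av` are. -/
theorem covShiftAv_holo {R : ℝ} (hWp : ∀ μ x a b, DifferentiableOn ℂ (fun u => Wp μ u x a b) (ball (0 : E) R))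
    (hWm : ∀ μ x a b, DifferentiableOn ℂ (fun u => Wm μ u x a b) (ball (0 : E) R))
    (hVav : ∀ p q, DifferentiableOn ℂ (fun u => Vav u p q) (ball (0 : E) R)) :
    ∀ p q, DifferentiableOn ℂ (fun u => (covShift P F Wp Wm u + Vav u) p q) (ball (0 : E) R) := fun p q => by
  simp only [Matrix.add_apply]
  exact (covShift_holo hWp hWm p q).add (hVav p q)

end Letter

/-! ## §2. Cor. 3.5's step for `V_W + V_av` on the genuine fibred flat propagator -/

section Step
variable {d L : ℕ} {a msq : ℝ}
variable {dd N' : ℕ} {E : Type*} [NormedAddCommGroup E] [NormedSpace ℂ E]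

/-- **[B9] COR. 3.5's STEP FOR THE COVARIANT SHIFT PLUS A CUBE-LOCAL AVERAGING CORRECTION.**  There are `δ₀, C > 0` (B6's) such that
for every member `i` of the one-scale torus family, every finite fibre `F`, every holomorphic family of transport defects `W^±` with
the bond window `ηα` and the divergence window `η²α′`, every holomorphic CUBE-LOCAL `V_av(u)` with row sums at most `α_av` on the ball
(the shape of `a(Lʲη)⁻²(Q′(U′)*Q′(U′) − Q′*Q′)` in (3.57)–(3.60)), every cube row sum `(μ, c_μ)`, rates as in 59b and the MARGIN
`c_μ(c_μ·1·(1·((α′ + α_av + Σ_ι α·covB δ₀ ι)C))c_μ)c_μ < 1`: `(G′ ⊗ 1)(1 − (V_W(u) + V_av(u))(G′ ⊗ 1))⁻¹` is a block walk expansion at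
`(ε − 2μ, ½δ₀ − ε − 3μ, ·, ½δ₀ − 2μ)` with the relative derivative letters `covB δ₀` and dominating distances; constants uniform in `K`,
the volume and the fibre. [cite: Balaban1985BackgroundPropagators, Cor. 3.5 p.407, (3.50)–(3.61) pp.400–402; Balaban1984PropagatorsII, Prop. 2.2 (2.67) p.234] -/
theorem blockWalkExpansion_covShiftAv_oneScaleTorus (hd : 1 ≤ d) (hL : Odd L ∧ 1 < L) (ha : 0 < a) (hmsq : 0 ≤ msq) :
    ∃ δ₀ C : ℝ, 0 < δ₀ ∧ 0 < C ∧ ∀ (i : Index d L) (F : Type) [Fintype F] [DecidableEq F] (c₀ : B13.Consts)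
      (X : Finset (UT (Nv i.P i.P.K))) (R : ℝ) (Wp Wm : Fin i.P.d → E → Site i.P 0 → Matrix F F ℂ)
      (Vav : E → Matrix (Site i.P 0 × F) (Site i.P 0 × F) ℂ) (α α' αav ε μ cμ : ℝ),
      (∀ ν x a' b, DifferentiableOn ℂ (fun u => Wp ν u x a' b) (ball (0 : E) R)) →
      (∀ ν x a' b, DifferentiableOn ℂ (fun u => Wm ν u x a' b) (ball (0 : E) R)) →
      (∀ p q, DifferentiableOn ℂ (fun u => Vav u p q) (ball (0 : E) R)) →
      0 ≤ α → 0 ≤ α' → 0 ≤ αav →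
      (∀ ν, ∀ u ∈ ball (0 : E) R, ∀ x a', ∑ b, ‖Wp ν u x a' b‖ ≤ i.P.eps * α) →
      (∀ ν, ∀ u ∈ ball (0 : E) R, ∀ x a', ∑ b, ‖Wm ν u x a' b‖ ≤ i.P.eps * α) →
      (∀ u ∈ ball (0 : E) R, ∀ x a', ∑ b, ‖(∑ ν, (Wp ν u x + Wm ν u x)) a' b‖ ≤ i.P.eps ^ 2 * α') →
      (∀ u p q, Vav u p q ≠ 0 → cubeOf i.P p.1 = cubeOf i.P q.1) →
      (∀ u ∈ ball (0 : E) R, ∀ p, ∑ q, ‖Vav u p q‖ ≤ αav) →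
      0 ≤ μ → 2 * μ ≤ ε → 2 * μ ≤ δ₀ / 2 - ε - μ → 0 ≤ cμ →
      RowSum (toB6 (torusGeom (Nv i.P i.P.K) 0 0 0) 0 True) μ cμ →
      cμ * (cμ * 1 * (1 * ((α' + αav + ∑ ι, α * covB i.P δ₀ ι) * C)) * cμ) * cμ < 1 →
      ∃ (W : Type) (T : W → (TPt dd N' → ℂ) → E → Matrix (Site i.P 0 × F) (Site i.P 0 × F) ℂ) (SX' : Set W) (A' : W → ℝ)
        (D' : W → UT (Nv i.P i.P.K) → UT (Nv i.P i.P.K) → ℝ),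
        BlockWalkExpansion c₀ (fun q : Site i.P 0 × F => cubeOf i.P q.1) (fun q : Site i.P 0 × F => cubeOf i.P q.1)
          (fun (_ : TPt dd N' → ℂ) u =>
            Matrix.blockDiagonal (fun _ : F => ((tower i.P a msq).G i.P.K).map ((↑) : ℝ → ℂ)) *
              (1 - (covShift i.P F Wp Wm u + Vav u) *
                Matrix.blockDiagonal (fun _ : F => ((tower i.P a msq).G i.P.K).map ((↑) : ℝ → ℂ)))⁻¹) X R
          (ε - 2 * μ) (δ₀ / 2 - ε - μ - 2 * μ)
          (cμ * C * (1 * (1 - cμ * (cμ * 1 * (1 * ((α' + αav + ∑ ι, α * covB i.P δ₀ ι) * C)) * cμ) * cμ)⁻¹) * cμ)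
          T SX' A' D' (δ₀ / 2 - 2 * μ) ∧
        (∀ (ι : Fin i.P.d ⊕ Fin i.P.d) ω (σ : TPt dd N' → ℂ), (∀ j, ‖σ j‖ ≤ Real.exp c₀.κ₁) → ∀ u ∈ ball (0 : E) R, ∀ Y Y',
          blockNorm (fun q : Site i.P 0 × F => cubeOf i.P q.1) (fun q : Site i.P 0 × F => cubeOf i.P q.1)
              (covDop i.P F ι * T ω σ u) Y Y' ≤
            covB i.P δ₀ ι * (A' ω * Real.exp (-((δ₀ / 2 - 2 * μ) * D' ω Y Y')))) ∧
        ∀ ω, DomBy (toB6 (torusGeom (Nv i.P i.P.K) 0 0 0) 0 True) (D' ω) := by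
  obtain ⟨δ₀, C, hδ₀, hC, hflat⟩ := flatLettersFibre_oneScaleTorus d L hd hL ha hmsq
  refine ⟨δ₀, C, hδ₀, hC, fun i F _ _ c₀ X R Wp Wm Vav α α' αav ε μ cμ hWph hWmh hVavh hα hα' hαav hWp hWm hdiv hloc hav hμ hμε hμκ
    hcμ hrow hq => ?_⟩
  set Gf := Matrix.blockDiagonal (fun _ : F => ((tower i.P a msq).G i.P.K).map ((↑) : ℝ → ℂ)) with hGf
  have hW := blockWalkExpansion_const (dd := dd) (N' := N') (E := E) c₀ (fun q : Site i.P 0 × F => cubeOf i.P q.1) X Gf R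
    (ε := ε) (κ := δ₀ / 2 - ε - μ) (ρ := δ₀ / 2) hC.le (by linarith) (fun Y Y' => (hflat i F Y Y').1)
  have hD : ∀ (ι : Fin i.P.d ⊕ Fin i.P.d) (ω : Unit) (σ : TPt dd N' → ℂ), (∀ j, ‖σ j‖ ≤ Real.exp c₀.κ₁) →
      ∀ u ∈ ball (0 : E) R, ∀ Y Y' : UT (Nv i.P i.P.K),
        blockNorm (fun q : Site i.P 0 × F => cubeOf i.P q.1) (fun q : Site i.P 0 × F => cubeOf i.P q.1)
            (covDop i.P F ι * Gf) Y Y' ≤ covB i.P δ₀ ι * (C * Real.exp (-(δ₀ / 2 * tdist1 (Nv i.P i.P.K) Y Y'))) := by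
    intro ι _ σ _ u _ Y Y'
    cases ι with
    | inl ν =>
        show blockNorm _ _ (Df i.P F ν * Gf) Y Y' ≤ 1 * _
        rw [one_mul]; exact (hflat i F Y Y').2 ν
    | inr ν =>
        show blockNorm _ _ (SBf i.P F ν * Df i.P F ν * Gf) Y Y' ≤ Real.exp (δ₀ / 2) * _
        rw [Matrix.mul_assoc]
        have h := blockNorm_SBf_mul_le ν (Df i.P F ν * Gf) hC.le (by linarith : (0 : ℝ) ≤ δ₀ / 2)
          (fun Y Y' => (hflat i F Y Y').2 ν) Y Y'
        calc _ ≤ _ := h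
          _ = _ := by ring
  exact blockWalkExpansion_perturb_of_derivLetters (Dop := covDop i.P F) (B := covB i.P δ₀) (V := fun u => covShift i.P F Wp Wm u + Vav u)
    hW (fun _ Y Y' => le_rfl) (fun ι => by cases ι <;> simp only [covB] <;> positivity) hD (covShiftAv_holo i.P F Wp Wm Vav hWph hWmh hVavh)
    (add_nonneg hα' hαav) (fun _ => hα) (covShiftAv_dominated i.P F Wp Wm Vav (fun x => cubeOf i.P x) hα hα' hαav hWp hWm hdiv hloc hav)
    hμ hμε hμκ (by linarith) hC.le hcμ hrow hq

end Step

end Summit.QuantumFields.BalabanUV.Gaps.D4WalkBlockCovariantAveraging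

end
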